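import Mathlib
import Summits.ValiantsHypothesis.ValiantsHypothesis.Theorems.NewtonUnitEquationsDissociatedUniformTotalsLawBinaryWalk
import HarnessLib

/-!
# Crux `NewtonUnitEquations.DissociatedUniform` (stmt-ValiantsHypothesis-5905): totals law, the binary row — the chart count `≤ 2n`

Fourth tool file for the `q = 2` row of the typed general totals law `TotalsLawN.TotalsLawGeneral` (companions
`…TotalsLawBinaryRuns/Charts/Walk`).  THE COUNT: along one affine half-chart `t ↦ (σ, t)`, the two parity classes of the
subset sums of `n = m + 1` planar vectors have together at most `2n` chart tops (`card_tops_add_card_tops_le`), with no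
general-position hypothesis.  Proof: every chart top, tagged by its parity, lies in the tagged pair `pairAt s` of its generic
witness sample (static top-two lemma); the union of the pairs over the fine sample is counted by TELESCOPING along the samples
(`card_biUnion_le_sum_sdiff`): a step between consecutive samples costs nothing unless the least minimiser `i₀` changes
(`≤ 1`: a change point of the labelling, at most `2·#reps - 2` of them by the runs theorem) or indices flip their sign, in which
case it costs `≤ 2·#(flipping non-representatives)` (`card_pairAt_sdiff_le`; flipping sets of different steps are disjoint, so
these add up to `≤ 2(n - #reps)`).  Total `2 + (2#reps - 2) + 2(n - #reps) = 2n`.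
[folklore: Davenport–Schinzel sequences of order 2 have length ≤ 2n − 1]
-/

set_option linter.dupNamespace false -- `ValiantsHypothesis.ValiantsHypothesis` (summit = problem) in every name

open scoped Classical BigOperators
open Finset Matrix
open Literature.Computability.AlgebraicComplexity.KPTT.PlanarMinkowski (IsStrictTop)

namespace Summit.ValiantsHypothesis.ValiantsHypothesis.Theorems.NewtonUnitEquationsDissociatedUniform

namespace TotalsLawN

namespace Binary

variable {m : ℕ}

/-! ### Telescoping along a finite set of reals -/

/-- The value of `π` at the immediate predecessor of `s` in `S` (`∅` if `s` is the least element). -/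
noncomputable def prevVal {X : Type*} (S : Finset ℝ) (π : ℝ → Finset X) (s : ℝ) : Finset X :=
  if h : (S.filter fun u => u < s).Nonempty then π ((S.filter fun u => u < s).max' h) else ∅

/-- The largest smaller member is the immediate predecessor. [folklore] -/
theorem isPred_max' {S : Finset ℝ} {s : ℝ} (h : (S.filter fun u => u < s).Nonempty) :
    IsPred S ((S.filter fun u => u < s).max' h) s := by
  refine ⟨(Finset.mem_filter.1 (Finset.max'_mem _ h)).1, (Finset.mem_filter.1 (Finset.max'_mem _ h)).2,
    fun w hw hpw => ?_⟩
  have : w ≤ (S.filter fun u => u < s).max' h := Finset.le_max' _ w (Finset.mem_filter.2 ⟨hw, hpw.2⟩)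
  exact absurd hpw.1 (not_lt.2 this)

/-- **Telescoping.** `#(⋃_{s ∈ S} π s) ≤ ∑_{s ∈ S} #(π s \ π (predecessor of s))`. [folklore] -/
theorem card_biUnion_le_sum_sdiff {X : Type*} [DecidableEq X] (S : Finset ℝ) (π : ℝ → Finset X) :
    (S.biUnion π).card ≤ ∑ s ∈ S, (π s \ prevVal S π s).card := by
  induction S using Finset.induction_on_max with
  | empty => simp
  | insert a S hlt ih =>
    have haS : a ∉ S := fun h => lt_irrefl a (hlt a h)
    -- predecessors inside `S` are unchanged by inserting the larger `a`
    have hfilt : ∀ b, b ≤ a → (insert a S).filter (fun u => u < b) = S.filter fun u => u < b := by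
      intro b hb
      rw [Finset.filter_insert, if_neg (not_lt.2 hb)]
    have hprev : ∀ b ∈ S, prevVal (insert a S) π b = prevVal S π b := by
      intro b hb
      unfold prevVal
      rw [hfilt b (hlt b hb).le]
    have hsum : ∑ s ∈ S, (π s \ prevVal (insert a S) π s).card = ∑ s ∈ S, (π s \ prevVal S π s).card :=
      Finset.sum_congr rfl fun b hb => by rw [hprev b hb]
    rw [Finset.sum_insert haS, hsum, Finset.biUnion_insert]
    -- the new part
    have hnew : (π a \ S.biUnion π).card ≤ (π a \ prevVal (insert a S) π a).card := by
      refine Finset.card_le_card (Finset.sdiff_subset_sdiff (Finset.Subset.refl _) ?_)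
      unfold prevVal
      split_ifs with h
      · have h' := Finset.mem_filter.1 (Finset.max'_mem _ h)
        have hmem : ((insert a S).filter fun u => u < a).max' h ∈ S := by
          rcases Finset.mem_insert.1 h'.1 with h'' | h''
          · exact absurd h'.2 (by rw [h'']; exact lt_irrefl a)
          · exact h''
        exact Finset.subset_biUnion_of_mem π hmem
      · exact Finset.empty_subset _
    calc (π a ∪ S.biUnion π).card = (π a \ S.biUnion π ∪ S.biUnion π).card := by
          rw [Finset.sdiff_union_self_eq_union]
      _ ≤ (π a \ S.biUnion π).card + (S.biUnion π).card := Finset.card_union_le _ _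
      _ ≤ (π a \ prevVal (insert a S) π a).card + ∑ s ∈ S, (π s \ prevVal S π s).card := add_le_add hnew ih

/-- At most one member has no smaller member. [folklore] -/
theorem card_filter_noPred_le_one (S : Finset ℝ) :
    (S.filter fun s => ¬ (S.filter fun u => u < s).Nonempty).card ≤ 1 := by
  refine Finset.card_le_one.2 fun a ha b hb => ?_
  obtain ⟨haS, ha'⟩ := Finset.mem_filter.1 ha
  obtain ⟨hbS, hb'⟩ := Finset.mem_filter.1 hb
  by_contra hne
  rcases lt_or_gt_of_ne hne with h | h
  · exact hb' ⟨a, Finset.mem_filter.2 ⟨haS, h⟩⟩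
  · exact ha' ⟨b, Finset.mem_filter.2 ⟨hbS, h⟩⟩

/-! ### Toggling membership -/

/-- `i ∈ K △ {i}` iff `i ∉ K`. [folklore] -/
theorem mem_tog_self {K : Finset (Fin (m + 1))} {i : Fin (m + 1)} : i ∈ tog K i ↔ i ∉ K := by
  unfold tog; split_ifs with h <;> simp [h]

/-- Other indices are untouched by toggling. [folklore] -/
theorem mem_tog_of_ne {K : Finset (Fin (m + 1))} {i k : Fin (m + 1)} (hk : k ≠ i) : k ∈ tog K i ↔ k ∈ K := by
  unfold tog; split_ifs with h <;> simp [hk]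

/-! ### The cost of one step -/

/-- A flipping index is never chart-null, and if some representative minimises at a sample then no index is null there:
precisely, if `i = i₀(s₀)` flips between generic times then there is NO null index at all. [folklore] -/
theorem no_null_of_rep_flips {v : Fin (m + 1) → (Fin 2 → ℝ)} {σ p s s₀ : ℝ} (hp : p ∉ events v σ)
    (hs : s ∉ events v σ) (hps : p < s) (hs₀ : s₀ ∉ events v σ) (hi : i0 v σ s₀ ∈ flips v σ p s)
    (j : Fin (m + 1)) : ¬ (alpha v σ j = 0 ∧ beta v j = 0) := by
  rintro ⟨ha, hb⟩
  obtain ⟨hbi, -⟩ := root_between_of_flip hp hs hps (mem_flips.1 hi)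
  have hj0 : ell v σ j s₀ = 0 := by rw [ell_eq, ha, hb, mul_zero, add_zero]
  have hle : |ell v σ (i0 v σ s₀) s₀| ≤ |ell v σ j s₀| := mem_Amin.1 (i0_mem v σ s₀) j
  rw [hj0, abs_zero] at hle
  have h0 : ell v σ (i0 v σ s₀) s₀ = 0 := abs_eq_zero.1 (le_antisymm hle (abs_nonneg _))
  exact hbi (null_of_ell_eq_zero hs₀ h0).2

/-- **Cost of a step.**  Between consecutive samples `p < s` the tagged pair changes by at most `[i₀ changes]` new elements
if no index flips, and by at most `2·#(flipping non-representatives)` otherwise (a single flipping representative swaps the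
two tagged points and changes nothing). [folklore] -/
theorem card_pairAt_sdiff_le {v : Fin (m + 1) → (Fin 2 → ℝ)} {σ p s : ℝ} (hps : IsPred (samples v σ) p s)
    (hs : s ∈ samples v σ) :
    (pairAt v σ s \ pairAt v σ p).card ≤ (if i0 v σ s = i0 v σ p then 0 else 1) +
      2 * ((flips v σ p s).filter fun i => i ∉ reps v σ).card := by
  by_cases hF : flips v σ p s = ∅
  · -- no flips: the top pattern is unchanged
    have hJ : J v σ s = J v σ p := J_eq_of_flips_eq_empty hF
    by_cases hi : i0 v σ s = i0 v σ p
    · rw [if_pos hi]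
      have : pairAt v σ s = pairAt v σ p := by unfold pairAt; rw [hJ, hi]
      rw [this, Finset.sdiff_self, Finset.card_empty]
      exact Nat.zero_le _
    · rw [if_neg hi]
      have hsub : pairAt v σ s \ pairAt v σ p ⊆
          {(P v (tog (J v σ s) (i0 v σ s)), ((J v σ s).card : ZMod 2) + 1)} := by
        intro x hx
        obtain ⟨hx1, hx2⟩ := Finset.mem_sdiff.1 hx
        rw [pairAt, Finset.mem_insert, Finset.mem_singleton] at hx1
        rcases hx1 with rfl | rfl
        · exact absurd (by rw [pairAt, hJ]; exact Finset.mem_insert_self _ _) hx2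
        · exact Finset.mem_singleton_self _
      exact (Finset.card_le_card hsub).trans (by rw [Finset.card_singleton]; omega)
  · have hFne : (flips v σ p s).Nonempty := Finset.nonempty_iff_ne_empty.2 hF
    by_cases hR : ((flips v σ p s).filter fun i => i ∉ reps v σ).Nonempty
    · have h2 : (pairAt v σ s \ pairAt v σ p).card ≤ 2 :=
        (Finset.card_le_card Finset.sdiff_subset).trans (card_pairAt_le v σ s)
      have h1 : 1 ≤ ((flips v σ p s).filter fun i => i ∉ reps v σ).card := Finset.card_pos.2 hR
      omega
    · -- every flipping index is a representative: exactly one flips, and it is `i₀` at both samples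
      have hall : ∀ i ∈ flips v σ p s, i ∈ reps v σ := by
        intro i hi; by_contra h; exact hR ⟨i, Finset.mem_filter.2 ⟨hi, h⟩⟩
      have hcard : (flips v σ p s).card ≤ 1 := by
        have := card_flips_filter_reps_le_one hps hs
        rwa [Finset.filter_true_of_mem hall] at this
      obtain ⟨i, hFi⟩ := Finset.card_eq_one.1 (le_antisymm hcard (Finset.card_pos.2 hFne))
      have hiF : i ∈ flips v σ p s := by rw [hFi]; exact Finset.mem_singleton_self _
      obtain ⟨s₀, hs₀, hs₀i⟩ := Finset.mem_image.1 (hall i hiF)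
      have hp := not_mem_events_of_mem_samples hps.1
      have hs' := not_mem_events_of_mem_samples hs
      have hnn := no_null_of_rep_flips hp hs' hps.2.1 (not_mem_events_of_mem_samples hs₀) (hs₀i ▸ hiF)
      -- the least minimisers at `p` and at `s` are `i`
      have hAp : i0 v σ p = i := by
        have h := mem_flips_or_null_of_mem_Amin_left hps hs hFne (i0_mem v σ p)
        rcases h with h | h
        · rw [hFi] at h; exact Finset.mem_singleton.1 h
        · exact absurd h (hnn _)
      have hAs : i0 v σ s = i := by
        have h := mem_flips_or_null_of_mem_Amin_right hps hs hFne (i0_mem v σ s)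
        rcases h with h | h
        · rw [hFi] at h; exact Finset.mem_singleton.1 h
        · exact absurd h (hnn _)
      -- the pattern at `s` is the toggled pattern at `p`
      have hJ : J v σ s = tog (J v σ p) i := by
        ext k
        by_cases hk : k = i
        · subst hk
          rw [mem_tog_self]
          have h := mem_flips.1 hiF
          tauto
        · rw [mem_tog_of_ne hk]
          have h : k ∉ flips v σ p s := by rw [hFi]; exact fun h => hk (Finset.mem_singleton.1 h)
          rw [mem_flips, not_not] at h
          exact h.symm
      have heq : pairAt v σ s = pairAt v σ p := by
        unfold pairAt
        rw [hAs, hAp, hJ, tog_tog, card_tog, add_assoc, show (1 : ZMod 2) + 1 = 0 by decide, add_zero,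
          Finset.pair_comm]
      rw [heq, Finset.sdiff_self, Finset.card_empty]
      exact Nat.zero_le _

/-! ### Flipping sets of different steps are disjoint -/

/-- An affine function changes sign at most once along increasing times. [folklore] -/
theorem not_flip_twice {v : Fin (m + 1) → (Fin 2 → ℝ)} {σ t₁ t₂ t₃ t₄ : ℝ} (h12 : t₁ ≤ t₂) (h23 : t₂ ≤ t₃)
    (h34 : t₃ ≤ t₄) {i : Fin (m + 1)} (hflip : ¬ (i ∈ J v σ t₁ ↔ i ∈ J v σ t₂)) :
    (i ∈ J v σ t₃ ↔ i ∈ J v σ t₄) := by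
  rw [mem_J, mem_J, ell_eq, ell_eq] at hflip ⊢
  rcases le_or_gt 0 (beta v i) with hb | hb
  · have m12 : alpha v σ i + t₁ * beta v i ≤ alpha v σ i + t₂ * beta v i := by nlinarith
    have m23 : alpha v σ i + t₂ * beta v i ≤ alpha v σ i + t₃ * beta v i := by nlinarith
    have m34 : alpha v σ i + t₃ * beta v i ≤ alpha v σ i + t₄ * beta v i := by nlinarith
    have h2 : 0 < alpha v σ i + t₂ * beta v i := by
      by_contra h2
      exact hflip (iff_of_false (fun h1 => h2 (h1.trans_le m12)) h2)
    exact iff_of_true (h2.trans_le m23) ((h2.trans_le m23).trans_le m34)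
  · have m12 : alpha v σ i + t₂ * beta v i ≤ alpha v σ i + t₁ * beta v i := by nlinarith
    have m23 : alpha v σ i + t₃ * beta v i ≤ alpha v σ i + t₂ * beta v i := by nlinarith
    have m34 : alpha v σ i + t₄ * beta v i ≤ alpha v σ i + t₃ * beta v i := by nlinarith
    have h2 : ¬ 0 < alpha v σ i + t₂ * beta v i := by
      intro h2
      exact hflip (iff_of_true (h2.trans_le m12) h2)
    exact iff_of_false (fun h3 => h2 (h3.trans_le m23)) (fun h4 => h2 ((h4.trans_le m34).trans_le m23))

/-- The flipping set of the step ending at `s` (empty for the least sample). -/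
noncomputable def stepFlips (v : Fin (m + 1) → (Fin 2 → ℝ)) (σ : ℝ) (S : Finset ℝ) (s : ℝ) : Finset (Fin (m + 1)) :=
  if h : (S.filter fun u => u < s).Nonempty then flips v σ ((S.filter fun u => u < s).max' h) s else ∅

/-- Flipping sets of different steps are disjoint. [folklore] -/
theorem stepFlips_disjoint (v : Fin (m + 1) → (Fin 2 → ℝ)) (σ : ℝ) (S : Finset ℝ) {s s' : ℝ} (hs : s ∈ S)
    (hs' : s' ∈ S) (hne : s ≠ s') : Disjoint (stepFlips v σ S s) (stepFlips v σ S s') := by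
  -- reduce to `s < s'`
  wlog hlt : s < s' generalizing s s'
  · exact (this hs' hs hne.symm (lt_of_le_of_ne (not_lt.1 hlt) hne.symm)).symm
  unfold stepFlips
  split_ifs with h h'
  · have hp := isPred_max' h
    have hp' := isPred_max' h'
    set p := (S.filter fun u => u < s).max' h
    set p' := (S.filter fun u => u < s').max' h'
    have hsp' : s ≤ p' := not_lt.1 fun hl => hp'.2.2 s hs ⟨hl, hlt⟩
    refine Finset.disjoint_left.2 fun i hi hi' => ?_
    exact (mem_flips.1 hi') (not_flip_twice hp.2.1.le hsp' hp'.2.1.le (mem_flips.1 hi))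
  · exact disjoint_bot_right
  · exact disjoint_bot_left
  · exact disjoint_bot_left

/-- **Budget.** The flipping non-representatives of all steps number at most `n - #reps`. [folklore] -/
theorem sum_card_stepFlips_le (v : Fin (m + 1) → (Fin 2 → ℝ)) (σ : ℝ) :
    ∑ s ∈ samples v σ, ((stepFlips v σ (samples v σ) s).filter fun i => i ∉ reps v σ).card ≤
      (m + 1) - (reps v σ).card := by
  rw [← Finset.card_biUnion]
  · calc ((samples v σ).biUnion fun s => (stepFlips v σ (samples v σ) s).filter fun i => i ∉ reps v σ).card
        ≤ (univ \ reps v σ).card := Finset.card_le_card fun i hi => by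
          obtain ⟨s, -, hs⟩ := Finset.mem_biUnion.1 hi
          exact Finset.mem_sdiff.2 ⟨mem_univ _, (Finset.mem_filter.1 hs).2⟩
      _ = (m + 1) - (reps v σ).card := by rw [Finset.card_univ_sdiff, Fintype.card_fin]
  · intro s hs s' hs' hne
    exact Finset.disjoint_filter_filter (stepFlips_disjoint v σ (samples v σ) hs hs' hne)

/-! ### The runs theorem applied to the least minimiser -/

/-- Comparison sets of the squared pairings are convex towards the steeper index. [folklore] -/
theorem convex_sq_lt (v : Fin (m + 1) → (Fin 2 → ℝ)) (σ : ℝ) (d d' : Fin (m + 1))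
    (h : beta v d' ^ 2 ≤ beta v d ^ 2) : Convex ℝ {t : ℝ | ell v σ d t ^ 2 < ell v σ d' t ^ 2} := by
  have hf : ConvexOn ℝ Set.univ fun t : ℝ => (beta v d ^ 2 - beta v d' ^ 2) • t ^ 2 +
      ((2 * (alpha v σ d * beta v d - alpha v σ d' * beta v d')) * t + (alpha v σ d ^ 2 - alpha v σ d' ^ 2)) := by
    refine ((Even.convexOn_pow (𝕜 := ℝ) even_two).smul (sub_nonneg.2 h)).add ⟨convex_univ, ?_⟩
    intro x _ y _ a b _ _ hab
    simp only [smul_eq_mul]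
    rw [show a * (2 * (alpha v σ d * beta v d - alpha v σ d' * beta v d') * x + (alpha v σ d ^ 2 - alpha v σ d' ^ 2)) +
        b * (2 * (alpha v σ d * beta v d - alpha v σ d' * beta v d') * y + (alpha v σ d ^ 2 - alpha v σ d' ^ 2)) =
        2 * (alpha v σ d * beta v d - alpha v σ d' * beta v d') * (a * x + b * y) +
          (a + b) * (alpha v σ d ^ 2 - alpha v σ d' ^ 2) by ring, hab, one_mul]
  have hset : {t : ℝ | ell v σ d t ^ 2 < ell v σ d' t ^ 2} = {t ∈ Set.univ | (beta v d ^ 2 - beta v d' ^ 2) • t ^ 2 +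
      ((2 * (alpha v σ d * beta v d - alpha v σ d' * beta v d')) * t + (alpha v σ d ^ 2 - alpha v σ d' ^ 2)) < 0} := by
    ext t
    rw [Set.mem_setOf_eq, Set.mem_setOf_eq, ell_eq, ell_eq, smul_eq_mul]
    constructor
    · intro ht; constructor; · exact Set.mem_univ _
      nlinarith [ht]
    · rintro ⟨-, ht⟩; nlinarith [ht]
  rw [hset]
  exact hf.convex_lt 0

/-- The labelling by least minimisers changes at most `2·#reps - 2` times along the sample. [folklore] -/
theorem card_changePts_i0_le (v : Fin (m + 1) → (Fin 2 → ℝ)) (σ : ℝ) (hS : (samples v σ).Nonempty) :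
    (changePts (samples v σ) (i0 v σ)).card + 2 ≤ 2 * (reps v σ).card := by
  refine card_changePts_add_two_le (fun i t => ell v σ i t ^ 2) (fun i => beta v i ^ 2) (convex_sq_lt v σ)
    (reps v σ) (samples v σ) (i0 v σ) hS (fun s hs => Finset.mem_image_of_mem _ hs) fun s hs d hd hne => ?_
  obtain ⟨s', hs', rfl⟩ := Finset.mem_image.1 hd
  have hgs := not_mem_events_of_mem_samples hs
  have hgs' := not_mem_events_of_mem_samples hs'
  -- `i₀(s')` does not minimise at `s`, so it is strictly beaten by `i₀(s)`
  have hnot : i0 v σ s' ∉ Amin v σ s := fun h => hne (i0_eq_of_i0_mem hgs hgs' h).symm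
  obtain ⟨k, hk⟩ : ∃ k, ¬ |ell v σ (i0 v σ s') s| ≤ |ell v σ k s| := by
    by_contra h
    exact hnot (mem_Amin.2 fun k => not_not.1 fun hk => h ⟨k, hk⟩)
  have hlt : |ell v σ (i0 v σ s) s| < |ell v σ (i0 v σ s') s| :=
    (mem_Amin.1 (i0_mem v σ s) k).trans_lt (not_le.1 hk)
  have := pow_lt_pow_left₀ hlt (abs_nonneg _) two_ne_zero
  rwa [sq_abs, sq_abs] at this

/-! ### The count -/

/-- Tagged chart tops inject into the union of the tagged pairs over the sample. [folklore] -/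
theorem card_tops_le_card_biUnion (v : Fin (m + 1) → (Fin 2 → ℝ)) (σ : ℝ) :
    (tops v σ 0).card + (tops v σ 1).card ≤ ((samples v σ).biUnion (pairAt v σ)).card := by
  set T0 := (tops v σ 0).image fun x => (x, (0 : ZMod 2)) with hT0
  set T1 := (tops v σ 1).image fun x => (x, (1 : ZMod 2)) with hT1
  have hsub : T0 ∪ T1 ⊆ (samples v σ).biUnion (pairAt v σ) := by
    intro y hy
    rcases Finset.mem_union.1 hy with h | h
    · obtain ⟨x, hx, rfl⟩ := Finset.mem_image.1 h
      exact Finset.mem_biUnion.2 ⟨_, wit_mem_samples hx, top_mem_pairAt (wit_spec hx).2⟩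
    · obtain ⟨x, hx, rfl⟩ := Finset.mem_image.1 h
      exact Finset.mem_biUnion.2 ⟨_, wit_mem_samples hx, top_mem_pairAt (wit_spec hx).2⟩
  have hdis : Disjoint T0 T1 := by
    refine Finset.disjoint_left.2 fun y h0 h1 => ?_
    obtain ⟨x, -, rfl⟩ := Finset.mem_image.1 h0
    obtain ⟨x', -, h⟩ := Finset.mem_image.1 h1
    have h2 := congrArg Prod.snd h
    dsimp only at h2
    exact absurd h2 (by decide)
  have h0 : T0.card = (tops v σ 0).card := Finset.card_image_of_injective _ fun a b h => (Prod.mk.inj h).1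
  have h1 : T1.card = (tops v σ 1).card := Finset.card_image_of_injective _ fun a b h => (Prod.mk.inj h).1
  rw [← h0, ← h1, ← Finset.card_union_of_disjoint hdis]
  exact Finset.card_le_card hsub

/-- The cost of the step ending at the sample `s`, in the three currencies (first sample / change point / flipping
non-representatives). [folklore] -/
theorem step_cost_le (v : Fin (m + 1) → (Fin 2 → ℝ)) (σ : ℝ) {s : ℝ} (hs : s ∈ samples v σ) :
    (pairAt v σ s \ prevVal (samples v σ) (pairAt v σ) s).card ≤
      2 * (if ¬ ((samples v σ).filter fun u => u < s).Nonempty then 1 else 0) +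
        ((if s ∈ changePts (samples v σ) (i0 v σ) then 1 else 0) +
          2 * ((stepFlips v σ (samples v σ) s).filter fun i => i ∉ reps v σ).card) := by
  by_cases h : ((samples v σ).filter fun u => u < s).Nonempty
  · have hp := isPred_max' h
    rw [prevVal, dif_pos h, stepFlips, dif_pos h, if_neg (not_not.2 h), mul_zero, zero_add]
    refine (card_pairAt_sdiff_le hp hs).trans (Nat.add_le_add_right ?_ _)
    by_cases h1 : i0 v σ s = i0 v σ (((samples v σ).filter fun u => u < s).max' h)
    · rw [if_pos h1]; exact Nat.zero_le _
    · rw [if_neg h1, if_pos (mem_changePts.2 ⟨hs, _, hp, fun h' => h1 h'.symm⟩)]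
  · rw [prevVal, dif_neg h, Finset.sdiff_empty, if_pos h, mul_one]
    exact (card_pairAt_le v σ s).trans (Nat.le_add_right _ _)

/-- **Chart count of the binary row.**  Along one half-chart, the two parity classes of the subset sums of `m + 1` planar
vectors have together at most `2(m + 1)` chart tops. [folklore] -/
theorem card_tops_add_card_tops_le (v : Fin (m + 1) → (Fin 2 → ℝ)) (σ : ℝ) :
    (tops v σ 0).card + (tops v σ 1).card ≤ 2 * (m + 1) := by
  by_cases hS : (samples v σ).Nonempty
  swap
  · -- no samples: no tops
    have h0 : ∀ e, tops v σ e = ∅ := fun e => Finset.eq_empty_of_forall_notMem fun x hx =>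
      hS ⟨_, wit_mem_samples hx⟩
    rw [h0, h0, Finset.card_empty]
    exact Nat.zero_le _
  have hA := card_tops_le_card_biUnion v σ
  have hB := card_biUnion_le_sum_sdiff (samples v σ) (pairAt v σ)
  have hD := Finset.sum_le_sum fun s hs => step_cost_le v σ hs
  rw [Finset.sum_add_distrib, Finset.sum_add_distrib, ← Finset.mul_sum, ← Finset.mul_sum,
    ← Finset.card_filter, ← Finset.card_filter, Finset.filter_mem_eq_inter,
    Finset.inter_eq_right.2 (changePts_subset (samples v σ) (i0 v σ))] at hD
  have hE := card_filter_noPred_le_one (samples v σ)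
  have hF := sum_card_stepFlips_le v σ
  have hG := card_changePts_i0_le v σ hS
  have hR : (reps v σ).card ≤ m + 1 := (Finset.card_le_univ _).trans (by rw [Fintype.card_fin])
  omega

end Binary

end TotalsLawN

end Summit.ValiantsHypothesis.ValiantsHypothesis.Theorems.NewtonUnitEquationsDissociatedUniform
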